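import Summits.CriticalPhenomena.PercolationContinuityZ3.Theorems.Transplant.PlanarSkeletonFrmFromDefs
import Summits.CriticalPhenomena.PercolationContinuityZ3.Theorems.Transplant.SkelFrmFromBFaceHoldsQ3VOf
import Summits.CriticalPhenomena.PercolationContinuityZ3.Theorems.Transplant.SkelFrmBFaceHoldsQ3VOf
import Summits.CriticalPhenomena.PercolationContinuityZ3.Theorems.Transplant.SkelFrmFromBChoiceResidQV
import Summits.CriticalPhenomena.PercolationContinuityZ3.Theorems.Transplant.SkelFrmBChoiceResidQV
import Summits.CriticalPhenomena.PercolationContinuityZ3.Theorems.Transplant.SkelFrmFromBChoiceRoomV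
import Summits.CriticalPhenomena.PercolationContinuityZ3.Theorems.Transplant.SkelFrmBChoiceRoomV
import Summits.CriticalPhenomena.PercolationContinuityZ3.Theorems.Transplant.SkelFrmFromBParamsCorrKGLen
import Summits.CriticalPhenomena.PercolationContinuityZ3.Theorems.Transplant.SkelFrmBParamsCorrKGLen
import Summits.CriticalPhenomena.PercolationContinuityZ3.Theorems.Transplant.SkelFrmFromBParamsFaceBandAR0
import Summits.CriticalPhenomena.PercolationContinuityZ3.Theorems.Transplant.SkelFrmBParamsFaceBandAR0
import Summits.CriticalPhenomena.PercolationContinuityZ3.Theorems.Transplant.SkelFrmFromBParamsFaceFloorsX2WA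
import Summits.CriticalPhenomena.PercolationContinuityZ3.Theorems.Transplant.SkelFrmBParamsFaceFloorsX2WA
import Summits.CriticalPhenomena.PercolationContinuityZ3.Theorems.Transplant.SkelFrmFromBParamsFaceFloorsY2WA
import Summits.CriticalPhenomena.PercolationContinuityZ3.Theorems.Transplant.SkelFrmBParamsFaceFloorsY2WA
import Summits.CriticalPhenomena.PercolationContinuityZ3.Theorems.Transplant.SkelFrmFromBChoiceDefsT
import Summits.CriticalPhenomena.PercolationContinuityZ3.Theorems.Transplant.SkelFrmBChoiceDefsT
import Summits.CriticalPhenomena.PercolationContinuityZ3.Theorems.Transplant.SkelFrmFromBChoiceCellsV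
import Summits.CriticalPhenomena.PercolationContinuityZ3.Theorems.Transplant.SkelFrmBChoiceCellsV
import HarnessLib
import Summits.CriticalPhenomena.PercolationContinuityZ3.Theorems.Transplant.SkelFrm1FaceHoldsQ3VNode
/-!
# U-WAVE PORT (RULING D-U, lead g21 2026-08-26; WAVE-U-MANIFEST v3.0 row «SkelFrm1FaceHoldsQ3VNode» ↦ «SkelFrmFrom1FaceHoldsQ3VNode») of the tree module
# `Transplant/SkelFrm1FaceHoldsQ3VNode` onto the carrier `PlanarSkeletonFrmFrom` (frames only, cylinders connected from width `ℓ₀` on)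

ORIGINAL TITLE: N2 (frames-only node `SamePDropOfSkeletonFrm₁`, OPEN) — (F) column, THE THIN INSTANCE OF RECORD: `NegB.faceHoldsRNQFnLTK_frmChoiceAllQ3V`

builds on p205010 (kernel theorem, internal audit signed; external expert review pending) — nothing in this file uses p205010; NOTHING is claimed about the
OPEN node U `SamePDropOfSkeletonFrmFrom₁` (nor U_s / the end state).  Lane `prim-bschramm`, seat `prim-hp-8 gen 53 (U-wave port pen, family P-hp8; tool of record = p3-g26 port_u.py)`; helper file
(`--supports stmt-CriticalPhenomena-4575 --as helper`).  PORT RULES r1–r4 of RULING D-U: declaration order and proof texts are those of the original,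
byte-identical except (i) the carrier token `PlanarSkeletonFrm ↦ PlanarSkeletonFrmFrom` (binders, `namespace`/`end` lines, qualified names of twinned
declarations), (ii) carrier-FREE declarations of the original (φ-level `Skelφ…` blocks and namespace-only arithmetic residents) are NOT re-declared —
this file imports the original and `export`s the twin-free residents (POLICY T / treatment (m1)); residents whose statement mentions a twinned
constant are copied, (iii) every carrier-binding declaration keeps its explicit binder `(Φ : PlanarSkeletonFrmFrom G)` in its own signature (r2).  Docstrings and citations are the original's.  Manifest row idx 237 (level 33; flags verbatim|RESIDENTS(T:0/free:1)); filed by the hp-8 lineage under RULING M-11 (family P-hp8).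
-/

noncomputable section

open scoped Classical ENNReal

namespace Summit.CriticalPhenomena.PercolationContinuityZ3.Theorems.Transplant

namespace PlanarSkeletonFrmFrom

namespace NegB

open MeasureTheory Literature.Probability.Percolation Literature.Probability.LatticeModels SimpleGraph KNCells KNLevels GadgetSystem Contour
open Literature.Probability.Percolation.KozmaNitzan
open Literature.Probability.Percolation.KozmaNitzan.Cells (oth sgOf sgOf_sign stepVec_apply_fst)
open Literature.Barriers.CriticalPhenomena (graphBall mem_graphBall_self graphBall_mono)
open BoxProdZ2 (ConcRadiiG Erad Frad nQ nS)
open ChainPlanar ChainPara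
open Skel (winGraph routeW excess WinStepData)
open SkelI (tanOff)
open TwoAxis.Para (modulus detD rep₂)
open SkelConc (Consts)
open Skelφ
open Skelφ.StepI (DataNS OutNS)
open Neg

export PlanarSkeletonFrm.NegB (faceNodeRows_arith_le)

set_option maxHeartbeats 1600000 in
/-- **THE (F) THIN INSTANCE OF RECORD** (see the module docstring): the face obligation of the choice function of record at the node tuple, under the
K-floor `480 ≤ Kmin ≤ κ.K₀`. [cite: KozmaNitzan2024, §4 Lemma 12 (pp. 23–25), Theorem 6 (pp. 25–31)] -/
theorem faceHoldsRNQFnLTK_frmChoiceAllQ3V (Kmin : ℕ) (hKmin : 480 ≤ Kmin) (mk : ℕ) (gxR fxR : PlanarSkeletonFrmFrom.Neg.FSlot) (exR : GSlot) (PxR : NegB.PSlot) :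
    FaceHoldsRNQFnLTK LfQ (fun x => x ^ 3) Kmin
      (frmChoiceAllQ3V (KS.gT mk (gxQ mk gxR fxR)) (KS.fT mk (fxQ mk fxR)) (KS.PR mk (PxQ mk PxR)) (SUS (exQ mk exR) (mxQ (mxF mk)))
        (cR2W mk) (hFR mk) BSlot.small3) := by
  refine faceHoldsRNQFnLTK_frmChoiceAllQ3V_of mk Kmin cF (gxQ mk gxR fxR) (fxQ mk fxR) (exQ mk exR) (mxQ (mxF mk)) (KS.PR mk (PxQ mk PxR))
    (cR2W mk) (hFR mk) LfQ ?_ ?_ ?_ ?_ ?_ ?_ ?_ ?_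
  · intro κ V _ _ G _ Φ t p D _; exact (le_gxQ mk gxR fxR κ Φ t p D).2.1
  · intro κ V _ _ G _ Φ t p D _; exact (le_fxQ mk fxR κ Φ t p D).2.1
  · intro κ V _ _ G _ Φ t p D g f _; exact exF2_le_exQ mk exR κ Φ t p D g f
  · intro κ V _ _ G _ Φ t p D g f; exact mF_le_mxF κ Φ t p D g f mk
  · intro κ V _ _ G _ Φ t p D _; exact (subset_PR_PxQ mk κ Φ t p D PxR).2.1 (Finset.mem_singleton_self _)
  · intro κ _
    rw [LfQ_eq κ, Neg.K_eq]
    have h1 := Neg.one_le_Kq κ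
    omega
  · intro κ _; have := (cF_eq κ).1; omega
  · intro κ V _ _ G _ Φ t p hC O q hK hAt
    -- the tuple's facts at `(O, q)`
    have hAt3 := atQ3_of_atQ3V hAt
    have hAtT := atQ3T_of_atQ3 hAt3
    -- (`gOf/fOf` are unfolded by their equation lemmas — never by unification against the `KS.gT mk (gxQ …)` towers)
    have hNL := eqNumL_of_atQT hAtT
    have hκ10 := (clauseL_of_atQT hAtT).2
    unfold gOf fOf at hNL hκ10
    have hKq : 13 ≤ Neg.Kq κ := PlanarSkeletonNeg.Neg.kq_ge_of_le κ (m := 12) (by omega)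
    have hKq5 : 5 ≤ Neg.Kq κ := by omega
    -- the box row `4·K·(R′0+2) ≤ M_L` and the creep lemmas' floors on `g`
    have hMR0 : 4 * Neg.K κ * (KS0.R'0 κ Φ t p O.merged mk + 2) ≤ ML κ Φ t p O.merged (KS.gT mk (gxQ mk gxR fxR) κ Φ t p O.merged) := by
      have h := (hR0F_of_ge (fun D => (le_gxQ mk gxR fxR κ Φ t p D).2.1) O.merged).1
      have h4 : 4 * Neg.K κ ≤ 22000 * Neg.Kq κ := by rw [Neg.K_eq]; omega
      exact (Nat.mul_le_mul_right (KS0.R'0 κ Φ t p O.merged mk + 2) h4).trans h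
    obtain ⟨hg, hg2⟩ := Hg_Q (κ := κ) (Φ := Φ) (t := t) (p := p) mk gxR fxR O.merged
    -- the stride units vs the radii (`r_J = 40·Kq·u_J`, `6R′0 + 11 ≤ u_J`)
    have hU0 := uA_oth_factsR0 κ Φ t p O.merged (KS.fT mk (fxQ mk fxR) κ Φ t p O.merged) mk (gxQ mk gxR fxR) hNL hκ10 hMR0 1
    have hU1 := uA_oth_factsR0 κ Φ t p O.merged (KS.fT mk (fxQ mk fxR) κ Φ t p O.merged) mk (gxQ mk gxR fxR) hNL hκ10 hMR0 0
    rw [show oth (1 : Fin 2) = 0 by decide, if_pos rfl] at hU0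
    rw [show oth (0 : Fin 2) = 1 by decide, if_neg (by decide)] at hU1
    obtain ⟨hr0, hu0, -⟩ := hU0
    obtain ⟨hr1, hu1, -⟩ := hU1
    have hKq' : (13 : ℤ) ≤ (Neg.Kq κ : ℤ) := by exact_mod_cast hKq
    have hR0 : (0 : ℤ) ≤ (KS0.R'0 κ Φ t p O.merged mk : ℤ) := Nat.cast_nonneg _
    have hr0' : 480 * (KS.u₀A κ Φ t p O.merged (KS.gT mk (gxQ mk gxR fxR) κ Φ t p O.merged) (KS.fT mk (fxQ mk fxR) κ Φ t p O.merged)) ≤ ((fcellsV κ Φ t p O.merged (KS.gT mk (gxQ mk gxR fxR) κ Φ t p O.merged) (KS.fT mk (fxQ mk fxR) κ Φ t p O.merged) (cOf κ Φ t p O (KS.gT mk (gxQ mk gxR fxR)) (KS.fT mk (fxQ mk fxR)) (cR2W mk)) (hOf κ Φ t p O (KS.gT mk (gxQ mk gxR fxR)) (KS.fT mk (fxQ mk fxR)) (hFR mk))).r 0 : ℤ) := by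
      rw [fcellsV_r, hr0]; nlinarith
    have hr1' : 480 * (KS.u₁A κ Φ t p O.merged (KS.gT mk (gxQ mk gxR fxR) κ Φ t p O.merged) (KS.fT mk (fxQ mk fxR) κ Φ t p O.merged)) ≤ ((fcellsV κ Φ t p O.merged (KS.gT mk (gxQ mk gxR fxR) κ Φ t p O.merged) (KS.fT mk (fxQ mk fxR) κ Φ t p O.merged) (cOf κ Φ t p O (KS.gT mk (gxQ mk gxR fxR)) (KS.fT mk (fxQ mk fxR)) (cR2W mk)) (hOf κ Φ t p O (KS.gT mk (gxQ mk gxR fxR)) (KS.fT mk (fxQ mk fxR)) (hFR mk))).r 1 : ℤ) := by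
      rw [fcellsV_r, hr1]; nlinarith
    -- the creep and the forward room of the cells (truncations are identities / upper bounds)
    have ecv : cOf κ Φ t p O (KS.gT mk (gxQ mk gxR fxR)) (KS.fT mk (fxQ mk fxR)) (cR2W mk) = (cR2vW κ Φ t p O.merged (KS.gT mk (gxQ mk gxR fxR) κ Φ t p O.merged) (KS.fT mk (fxQ mk fxR) κ Φ t p O.merged) mk) := by
      simp only [cOf, gOf, fOf, cR2W]
    have ehv : hOf κ Φ t p O (KS.gT mk (gxQ mk gxR fxR)) (KS.fT mk (fxQ mk fxR)) (hFR mk) = (hFRv κ Φ t p O.merged (KS.gT mk (gxQ mk gxR fxR) κ Φ t p O.merged) (KS.fT mk (fxQ mk fxR) κ Φ t p O.merged) mk) := by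
      simp only [hOf, gOf, fOf, hFR]
    have hcle := cR2vW_le_r_oth κ Φ t p O.merged (KS.gT mk (gxQ mk gxR fxR) κ Φ t p O.merged) (KS.fT mk (fxQ mk fxR) κ Φ t p O.merged) mk hKq5 hNL hg hg2
    have hc0 : ((fcellsV κ Φ t p O.merged (KS.gT mk (gxQ mk gxR fxR) κ Φ t p O.merged) (KS.fT mk (fxQ mk fxR) κ Φ t p O.merged) (cOf κ Φ t p O (KS.gT mk (gxQ mk gxR fxR)) (KS.fT mk (fxQ mk fxR)) (cR2W mk)) (hOf κ Φ t p O (KS.gT mk (gxQ mk gxR fxR)) (KS.fT mk (fxQ mk fxR)) (hFR mk))).c 0 : ℤ) = (((cR2vW κ Φ t p O.merged (KS.gT mk (gxQ mk gxR fxR) κ Φ t p O.merged) (KS.fT mk (fxQ mk fxR) κ Φ t p O.merged) mk) 0 : ℕ) : ℤ) := by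
      rw [fcellsV_c, ecv, cT_eq κ Φ t p O.merged (KS.gT mk (gxQ mk gxR fxR) κ Φ t p O.merged) (KS.fT mk (fxQ mk fxR) κ Φ t p O.merged) _ hcle]
    have hc1 : ((fcellsV κ Φ t p O.merged (KS.gT mk (gxQ mk gxR fxR) κ Φ t p O.merged) (KS.fT mk (fxQ mk fxR) κ Φ t p O.merged) (cOf κ Φ t p O (KS.gT mk (gxQ mk gxR fxR)) (KS.fT mk (fxQ mk fxR)) (cR2W mk)) (hOf κ Φ t p O (KS.gT mk (gxQ mk gxR fxR)) (KS.fT mk (fxQ mk fxR)) (hFR mk))).c 1 : ℤ) = (((cR2vW κ Φ t p O.merged (KS.gT mk (gxQ mk gxR fxR) κ Φ t p O.merged) (KS.fT mk (fxQ mk fxR) κ Φ t p O.merged) mk) 1 : ℕ) : ℤ) := by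
      rw [fcellsV_c, ecv, cT_eq κ Φ t p O.merged (KS.gT mk (gxQ mk gxR fxR) κ Φ t p O.merged) (KS.fT mk (fxQ mk fxR) κ Φ t p O.merged) _ hcle]
    have hF0 : ((fcellsV κ Φ t p O.merged (KS.gT mk (gxQ mk gxR fxR) κ Φ t p O.merged) (KS.fT mk (fxQ mk fxR) κ Φ t p O.merged) (cOf κ Φ t p O (KS.gT mk (gxQ mk gxR fxR)) (KS.fT mk (fxQ mk fxR)) (cR2W mk)) (hOf κ Φ t p O (KS.gT mk (gxQ mk gxR fxR)) (KS.fT mk (fxQ mk fxR)) (hFR mk))).hF 0 : ℤ) ≤ (((hFRv κ Φ t p O.merged (KS.gT mk (gxQ mk gxR fxR) κ Φ t p O.merged) (KS.fT mk (fxQ mk fxR) κ Φ t p O.merged) mk) 0 : ℕ) : ℤ) := by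
      rw [fcellsV_hF, ehv]; exact_mod_cast (hFV_le κ Φ t p O.merged (KS.gT mk (gxQ mk gxR fxR) κ Φ t p O.merged) (KS.fT mk (fxQ mk fxR) κ Φ t p O.merged) _ 0).2
    have hF1 : ((fcellsV κ Φ t p O.merged (KS.gT mk (gxQ mk gxR fxR) κ Φ t p O.merged) (KS.fT mk (fxQ mk fxR) κ Φ t p O.merged) (cOf κ Φ t p O (KS.gT mk (gxQ mk gxR fxR)) (KS.fT mk (fxQ mk fxR)) (cR2W mk)) (hOf κ Φ t p O (KS.gT mk (gxQ mk gxR fxR)) (KS.fT mk (fxQ mk fxR)) (hFR mk))).hF 1 : ℤ) ≤ (((hFRv κ Φ t p O.merged (KS.gT mk (gxQ mk gxR fxR) κ Φ t p O.merged) (KS.fT mk (fxQ mk fxR) κ Φ t p O.merged) mk) 1 : ℕ) : ℤ) := by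
      rw [fcellsV_hF, ehv]; exact_mod_cast (hFV_le κ Φ t p O.merged (KS.gT mk (gxQ mk gxR fxR) κ Φ t p O.merged) (KS.fT mk (fxQ mk fxR) κ Φ t p O.merged) _ 1).2
    obtain ⟨eH0, eH1⟩ := hFRv_apply κ Φ t p O.merged (KS.gT mk (gxQ mk gxR fxR) κ Φ t p O.merged) (KS.fT mk (fxQ mk fxR) κ Φ t p O.merged) mk
    obtain ⟨eC0, eC1⟩ := cR2vW_apply κ Φ t p O.merged (KS.gT mk (gxQ mk gxR fxR) κ Φ t p O.merged) (KS.fT mk (fxQ mk fxR) κ Φ t p O.merged) mk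
    obtain ⟨hcap0, hcap1⟩ := cR2vW_caps κ Φ t p O.merged (KS.gT mk (gxQ mk gxR fxR) κ Φ t p O.merged) (KS.fT mk (fxQ mk fxR) κ Φ t p O.merged) mk hKq5 hNL hg hg2
    have hhF0 : ((fcellsV κ Φ t p O.merged (KS.gT mk (gxQ mk gxR fxR) κ Φ t p O.merged) (KS.fT mk (fxQ mk fxR) κ Φ t p O.merged) (cOf κ Φ t p O (KS.gT mk (gxQ mk gxR fxR)) (KS.fT mk (fxQ mk fxR)) (cR2W mk)) (hOf κ Φ t p O (KS.gT mk (gxQ mk gxR fxR)) (KS.fT mk (fxQ mk fxR)) (hFR mk))).hF 0 : ℤ) ≤ (((cR2vW κ Φ t p O.merged (KS.gT mk (gxQ mk gxR fxR) κ Φ t p O.merged) (KS.fT mk (fxQ mk fxR) κ Φ t p O.merged) mk) 0 : ℕ) : ℤ) + 5 * (KS.u₁A κ Φ t p O.merged (KS.gT mk (gxQ mk gxR fxR) κ Φ t p O.merged) (KS.fT mk (fxQ mk fxR) κ Φ t p O.merged)) + 2 := by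
      rw [eC0]; rw [eH0] at hF0; unfold KS.u₁A; push_cast at hF0 ⊢; linarith
    have hhF1 : ((fcellsV κ Φ t p O.merged (KS.gT mk (gxQ mk gxR fxR) κ Φ t p O.merged) (KS.fT mk (fxQ mk fxR) κ Φ t p O.merged) (cOf κ Φ t p O (KS.gT mk (gxQ mk gxR fxR)) (KS.fT mk (fxQ mk fxR)) (cR2W mk)) (hOf κ Φ t p O (KS.gT mk (gxQ mk gxR fxR)) (KS.fT mk (fxQ mk fxR)) (hFR mk))).hF 1 : ℤ) ≤ (((cR2vW κ Φ t p O.merged (KS.gT mk (gxQ mk gxR fxR) κ Φ t p O.merged) (KS.fT mk (fxQ mk fxR) κ Φ t p O.merged) mk) 1 : ℕ) : ℤ) + 54 * (KS.u₀A κ Φ t p O.merged (KS.gT mk (gxQ mk gxR fxR) κ Φ t p O.merged) (KS.fT mk (fxQ mk fxR) κ Φ t p O.merged)) + 2 := by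
      rw [eC1]; rw [eH1] at hF1; unfold KS.u₀A; push_cast at hF1 ⊢; linarith
    have hcap0' : (((cR2vW κ Φ t p O.merged (KS.gT mk (gxQ mk gxR fxR) κ Φ t p O.merged) (KS.fT mk (fxQ mk fxR) κ Φ t p O.merged) mk) 0 : ℕ) : ℤ) ≤ 30 * (KS.u₁A κ Φ t p O.merged (KS.gT mk (gxQ mk gxR fxR) κ Φ t p O.merged) (KS.fT mk (fxQ mk fxR) κ Φ t p O.merged)) + 1 := by unfold KS.u₁A; exact hcap0
    have hcap1' : (((cR2vW κ Φ t p O.merged (KS.gT mk (gxQ mk gxR fxR) κ Φ t p O.merged) (KS.fT mk (fxQ mk fxR) κ Φ t p O.merged) mk) 1 : ℕ) : ℤ) ≤ 126 * (KS.u₀A κ Φ t p O.merged (KS.gT mk (gxQ mk gxR fxR) κ Φ t p O.merged) (KS.fT mk (fxQ mk fxR) κ Φ t p O.merged)) := by unfold KS.u₀A; exact hcap1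
    -- the windows
    obtain ⟨es0, es1⟩ := small3_eq κ Φ t p O.merged (KS.gT mk (gxQ mk gxR fxR) κ Φ t p O.merged) (KS.fT mk (fxQ mk fxR) κ Φ t p O.merged)
    have hbX : 13 * (KS.u₁A κ Φ t p O.merged (KS.gT mk (gxQ mk gxR fxR) κ Φ t p O.merged) (KS.fT mk (fxQ mk fxR) κ Φ t p O.merged)) ≤ ((KS.bwX κ Φ t p O.merged (KS.gT mk (gxQ mk gxR fxR) κ Φ t p O.merged) (KS.fT mk (fxQ mk fxR) κ Φ t p O.merged)) : ℤ) := by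
      have h := (KS.bwX_eq κ Φ t p O.merged (KS.gT mk (gxQ mk gxR fxR) κ Φ t p O.merged) (KS.fT mk (fxQ mk fxR) κ Φ t p O.merged)).1; rw [es1] at h; unfold KS.u₁A at h ⊢; push_cast at h; linarith
    have hbY : 69 * (KS.u₀A κ Φ t p O.merged (KS.gT mk (gxQ mk gxR fxR) κ Φ t p O.merged) (KS.fT mk (fxQ mk fxR) κ Φ t p O.merged)) ≤ ((KS.bwY κ Φ t p O.merged (KS.gT mk (gxQ mk gxR fxR) κ Φ t p O.merged) (KS.fT mk (fxQ mk fxR) κ Φ t p O.merged)) : ℤ) := by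
      have h := (KS.bwY_eq κ Φ t p O.merged (KS.gT mk (gxQ mk gxR fxR) κ Φ t p O.merged) (KS.fT mk (fxQ mk fxR) κ Φ t p O.merged)).1; rw [es0] at h; unfold KS.u₀A at h ⊢; push_cast at h; linarith
    -- the band `E − 1 ≤ 2R′0 − 3`
    have hE1 : 1 ≤ (KS0.Rlev0 κ Φ t p O.merged mk + KS0.reach0 t O.merged mk) := by unfold KS0.reach0; omega
    have hEc : ((((KS0.Rlev0 κ Φ t p O.merged mk + KS0.reach0 t O.merged mk) - 1 : ℕ)) : ℤ) = ((KS0.Rlev0 κ Φ t p O.merged mk + KS0.reach0 t O.merged mk) : ℤ) - 1 := by omega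
    have hReach : KS0.reach0 t O.merged mk < KS0.R'0 κ Φ t p O.merged mk := (KS0.T0_lt_R'0 κ Φ t p O.merged mk).2.2.1
    have hR' : KS0.R'0 κ Φ t p O.merged mk = KS0.Rlev0 κ Φ t p O.merged mk + 1 := rfl
    have he : ((((KS0.Rlev0 κ Φ t p O.merged mk + KS0.reach0 t O.merged mk) - 1 : ℕ)) : ℤ) + 3 ≤ 2 * (KS0.R'0 κ Φ t p O.merged mk : ℤ) := by
      rw [hEc]; omega
    -- the arithmetic
    have H := faceNodeRows_arith_le ((fcellsV κ Φ t p O.merged (KS.gT mk (gxQ mk gxR fxR) κ Φ t p O.merged) (KS.fT mk (fxQ mk fxR) κ Φ t p O.merged) (cOf κ Φ t p O (KS.gT mk (gxQ mk gxR fxR)) (KS.fT mk (fxQ mk fxR)) (cR2W mk)) (hOf κ Φ t p O (KS.gT mk (gxQ mk gxR fxR)) (KS.fT mk (fxQ mk fxR)) (hFR mk))).c 0) ((fcellsV κ Φ t p O.merged (KS.gT mk (gxQ mk gxR fxR) κ Φ t p O.merged) (KS.fT mk (fxQ mk fxR) κ Φ t p O.merged) (cOf κ Φ t p O (KS.gT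 mk (gxQ mk gxR fxR)) (KS.fT mk (fxQ mk fxR)) (cR2W mk)) (hOf κ Φ t p O (KS.gT mk (gxQ mk gxR fxR)) (KS.fT mk (fxQ mk fxR)) (hFR mk))).c 1) ((fcellsV κ Φ t p O.merged (KS.gT mk (gxQ mk gxR fxR) κ Φ t p O.merged) (KS.fT mk (fxQ mk fxR) κ Φ t p O.merged) (cOf κ Φ t p O (KS.gT mk (gxQ mk gxR fxR)) (KS.fT mk (fxQ mk fxR)) (cR2W mk)) (hOf κ Φ t p O (KS.gT mk (gxQ mk gxR fxR)) (KS.fT mk (fxQ mk fxR)) (hFR mk))).hF 0) ((fcellsV κ Φ t p O.merged (KS.gT mk (gxQ mk gxR fxR) κ Φ t p O.merged) (KS.fT mk (fxQ mk fxR) κ Φ t p O.merged) (cOf κ Φ t p O (KS.gT mk (gxQ mk gxR fxR)) (KS.fT mk (fxQ mk fxR)) (cR2W mk)) (hOf κ Φ t p O (KS.gT mk (gxQ mk gxR fxR)) (KS.fT mk (fxQ mk fxR)) (hFR mk))).hF 1) ((fcellsV κ Φ t p O.merged (KS.gT mk (gxQ mk gxR fxR) κ Φ t p O.merged) (KS.fT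 mk (fxQ mk fxR) κ Φ t p O.merged) (cOf κ Φ t p O (KS.gT mk (gxQ mk gxR fxR)) (KS.fT mk (fxQ mk fxR)) (cR2W mk)) (hOf κ Φ t p O (KS.gT mk (gxQ mk gxR fxR)) (KS.fT mk (fxQ mk fxR)) (hFR mk))).r 0) ((fcellsV κ Φ t p O.merged (KS.gT mk (gxQ mk gxR fxR) κ Φ t p O.merged) (KS.fT mk (fxQ mk fxR) κ Φ t p O.merged) (cOf κ Φ t p O (KS.gT mk (gxQ mk gxR fxR)) (KS.fT mk (fxQ mk fxR)) (cR2W mk)) (hOf κ Φ t p O (KS.gT mk (gxQ mk gxR fxR)) (KS.fT mk (fxQ mk fxR)) (hFR mk))).r 1) ((KS.bwX κ Φ t p O.merged (KS.gT mk (gxQ mk gxR fxR) κ Φ t p O.merged) (KS.fT mk (fxQ mk fxR) κ Φ t p O.merged)) : ℤ) ((KS.bwY κ Φ t p O.merged (KS.gT mk (gxQ mk gxR fxR) κ Φ t p O.merged) (KS.fT mk (fxQ mk fxR) κ Φ t p O.merged)) : ℤ)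
      (KS.u₀A κ Φ t p O.merged (KS.gT mk (gxQ mk gxR fxR) κ Φ t p O.merged) (KS.fT mk (fxQ mk fxR) κ Φ t p O.merged)) (KS.u₁A κ Φ t p O.merged (KS.gT mk (gxQ mk gxR fxR) κ Φ t p O.merged) (KS.fT mk (fxQ mk fxR) κ Φ t p O.merged)) ((((KS0.Rlev0 κ Φ t p O.merged mk + KS0.reach0 t O.merged mk) - 1 : ℕ)) : ℤ) (KS0.R'0 κ Φ t p O.merged mk : ℤ)
      (by rw [hc0]; exact hhF0) (by rw [hc1]; exact hhF1) (by rw [hc0]; exact hcap0') (by rw [hc1]; exact hcap1') hbX hbY hr0' hr1' hR0 hu0 hu1 he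
    exact H

end NegB

end PlanarSkeletonFrmFrom

end Summit.CriticalPhenomena.PercolationContinuityZ3.Theorems.Transplant

end
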